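import Summits.BirchSwinnertonDyer.BirchSwinnertonDyer.Theses.UniversalToricDescent
import HarnessLib

/-!
# Route `UniversalToricDescent` — the assembly item `Assembly` (stmt-BirchSwinnertonDyer-20391)

Seat `bsd-potss-kmc`, gen 18 (cell `bsd-potss`; kernel service on route `UniversalToricDescent`,
rev 11). `Assembly` is (since rev 8) one binder weaker than the type of the route's deciding theorem
`closes`: it still displays the ASIDE `WildRankOneOffCellAtThree` and concludes the whole wild
rank-one leaf `WAllExclAddWildRankOne`, re-assembled from the twin cell (the kernel's conclusion via
`wAllExclAddWildRankOneSurjTwin_of_forall`) and the off-cell aside (= the complement leaf verbatim)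
by ty-1's `wAllExclAddWildRankOne_of_surjTwin_of_offSurjTwin`. HONEST FRAMING: pure logic; every
crux stays a hypothesis; BSD is not advanced by this.

References: [JetchevSkinnerWan2017] §7.4.
-/

set_option linter.dupNamespace false

namespace Summit.BirchSwinnertonDyer.BirchSwinnertonDyer.Theorems

open Summit.BirchSwinnertonDyer.BirchSwinnertonDyer.Theses.UniversalToricDescent

/-- **`Assembly` (item 20391) holds**: published inputs → the four cruxes → the rank-zero residual →
the off-cell aside → the kernel ⟹ the wild rank-one leaf `WAllExclAddWildRankOne`, by the kernel on
the twin cell and the aside off it. [cite: JetchevSkinnerWan2017, §7.4] -/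
theorem universalToricDescent_assembly_proof : Assembly := by
  unfold Assembly
  intro hF hT hI hV hC hZ hOff hK
  exact Summit.BirchSwinnertonDyer.wAllExclAddWildRankOne_of_surjTwin_of_offSurjTwin
    (Summit.BirchSwinnertonDyer.wAllExclAddWildRankOneSurjTwin_of_forall (hK hF hT hI hV hC hZ)) hOff

end Summit.BirchSwinnertonDyer.BirchSwinnertonDyer.Theorems
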